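import Mathlib

/-!
# Floquet multipliers under a spatio-temporal symmetry of order three

Kernel form of the PARITY SENTENCE used for class-(III) hosts of the ns-blowup cell
(refuter K-CHECK 2026-08-25 12:11Z (a); instab draft prereg P-X1″-B, H2):
the breathing ABC host `abc(1 + δ cos(Ω t + 2π j/3))` has the spatio-temporal symmetry
`𝒞 = P ∘ τ_{T/3}` (cyclic axis permutation composed with a shift by a third of the period),
so the period map factorises as `M = K ^ 3` with `K = P⁻¹ ∘ Φ_{T/3}` (this factorisation is
the modelling INPUT, hypothesis `hM` below).  The algebraic content is then elementary and is
what is proved here, over an arbitrary field: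

* `exists_cube_root_of_simple` — if `M = K ^ 3`, `M v = μ • v` with `v ≠ 0` and the
  `μ`-eigenspace of `M` is one-dimensional (every `μ`-eigenvector is a multiple of `v`), then
  `v` is an eigenvector of `K` itself, `K v = κ • v`, with `κ ^ 3 = μ`.  In words: a SIMPLE
  multiplier is automatically in the trivial symmetry class — the mode is `𝒞`-invariant up to the
  scalar `κ`, so no "parity zero" can be inferred at a `P`-fixed anchor, and the imports at
  `P`-cycled anchors coincide after the `T/3` shift (the engine consistency check of record).
* `cube_root_pos` — over `ℝ`, a positive real multiplier `μ > 0` forces `κ > 0`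
  (`κ` is the real cube root), i.e. no sign alternation between the thirds of the period.

WHAT THIS IS NOT: not a statement about Navier–Stokes; finite-dimensional linear algebra
(it applies verbatim to the monodromy operator restricted to any finite-dimensional invariant
subspace, e.g. a Krylov/Ritz block).  No new definitions.
-/

namespace Summit.NavierStokesRegularity.FluidComputer.FloquetCubeRootClass

variable {R : Type*} [Field R] {V : Type*} [AddCommGroup V] [Module R V]

/-- If the period map is a cube, `M = K ^ 3`, then every eigenvector of `M` whose eigenvalue
has a one-dimensional eigenspace is an eigenvector of `K`, with eigenvalue a cube root of the
multiplier. -/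
theorem exists_cube_root_of_simple (K M : Module.End R V) (hM : M = K ^ 3)
    {μ : R} {v : V} (hv : v ≠ 0) (hMv : M v = μ • v)
    (hsimple : ∀ w : V, M w = μ • w → ∃ a : R, w = a • v) :
    ∃ κ : R, K v = κ • v ∧ κ ^ 3 = μ := by
  have h3 : ∀ w : V, M w = K (K (K w)) := by
    intro w
    rw [hM, pow_succ, pow_two, Module.End.mul_apply, Module.End.mul_apply]
  have hcomm : M (K v) = μ • K v := by
    calc M (K v) = K (K (K (K v))) := h3 _
      _ = K (M v) := by rw [h3]
      _ = μ • K v := by rw [hMv, map_smul]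
  obtain ⟨κ, hκ⟩ := hsimple (K v) hcomm
  refine ⟨κ, hκ, ?_⟩
  have hM3 : M v = (κ ^ 3) • v := by
    rw [h3, hκ, map_smul, hκ, smul_smul, map_smul, hκ, smul_smul]
    ring_nf
  have h : (κ ^ 3) • v = μ • v := hM3.symm.trans hMv
  exact smul_left_injective R hv h

/-- Over `ℝ`: a positive multiplier has a positive real cube root — the `K`-eigenvalue of a
simple positive-multiplier mode is positive (no sign alternation between the thirds of the
period). -/
theorem cube_root_pos {κ μ : ℝ} (hκ : κ ^ 3 = μ) (hμ : 0 < μ) : 0 < κ := by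
  have hodd : Odd 3 := by decide
  exact (hodd.pow_pos_iff).mp (hκ ▸ hμ)

/-- Packaged real form used by the cell: simple positive multiplier ⇒ trivial `ℤ₃` class with a
positive scalar. -/
theorem trivial_class_of_simple_pos {V : Type*} [AddCommGroup V] [Module ℝ V]
    (K M : Module.End ℝ V) (hM : M = K ^ 3)
    {μ : ℝ} {v : V} (hv : v ≠ 0) (hMv : M v = μ • v) (hμ : 0 < μ)
    (hsimple : ∀ w : V, M w = μ • w → ∃ a : ℝ, w = a • v) :
    ∃ κ : ℝ, 0 < κ ∧ K v = κ • v ∧ κ ^ 3 = μ := by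
  obtain ⟨κ, hK, hκ⟩ := exists_cube_root_of_simple K M hM hv hMv hsimple
  exact ⟨κ, cube_root_pos hκ hμ, hK, hκ⟩

end Summit.NavierStokesRegularity.FluidComputer.FloquetCubeRootClass
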